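import Literature.Geometry.Kaehler.ComplexTorusWeilHodgePlane
import Literature.Geometry.Kaehler.ComplexTorusWeilNoCurves
import Literature.Geometry.Kaehler.ComplexTorusSubvarieties
import Literature.Geometry.Kaehler.AnalyticSetBranchLocus
import Literature.Geometry.Kaehler.AnalyticSetSingularLocusCodim
import Literature.Geometry.Kaehler.AnalyticSetRegularUnion
import Literature.Geometry.Kaehler.AnalyticSetComponentsProofs
import Literature.Geometry.Kaehler.HolomorphicChainLelongProofs
import HarnessLib

/-!
# The explicit complex torus of Weil type carries no analytic surface

Layer `Literature/Geometry/Kaehler`; lane `lit-hodgefound` (Track 2 foundations library), Layer A4, row A4-108 (FILE B) of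
`run/shared/lean/pub/lit-hodgefound/SKELETON.md` (seat skel-4). Sequel of `ComplexTorusWeilHodgePlane.lean` (FILE A:
`B²(X)` is the Weil plane, so every rational `(2,2)`-class of the explicit torus of Weil type `X = ℂ⁴/Φ(ℤ⁸)` lies in
`span_ℂ(Ω, Ω̄)`, `Ω = dz₀ ∧ dz₁ ∧ dz̄₂ ∧ dz̄₃`), of `ComplexTorusWeilNoCurves.lean` (no analytic curve) and of
`ComplexTorusEuclideanPresentation.lean` (no analytic hypersurface; change of model). Main results:

* `ComplexTorus.not_hasPureDim_of_forall_nonneg_integralHodgeClass_eq_zero_model` — the tree's cycle-class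
  obstruction `not_hasPureDim_of_forall_nonneg_integralHodgeClass_eq_zero` ("no non-zero integral `(p,p)`-class
  non-negative on complex `p`-frames ⇒ no closed analytic subset of codimension `p`"), stated there for tori modelled
  on a complex inner-product space, transported to an ARBITRARY finite-dimensional model `E` (the sup-normed `ℂ⁴` of
  the explicit Weil torus) along the Euclidean presentation;
* `Weil.Omega_eq_det` — the Weil form as a `4 × 4` determinant, `Ω(v₀, …, v₃) = det (z₀(v_r), z₁(v_r), z̄₂(v_r),
  z̄₃(v_r))_r`, and its values `Ω(u, iu, w, iw) = 4 c̄` on the complex `2`-frames `u = e₀ + c e₂`, `w = e₁ + e₃`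
  (`Omega_twoFrame`);
* `Weil.eq_zero_of_mem_span_Omega_of_forall_nonneg` — **a class `a Ω + b Ω̄` which is non-negative on all complex
  `2`-frames `(u, iu, w, iw)` vanishes** (the four frames with `c = ±1, ±i` give `±4(a + b) ≥ 0` and
  `±4i(b − a) ≥ 0`);
* `Weil.not_hasPureDim_two` — **the explicit torus of Weil type has no closed analytic subset of pure dimension two**;
  with rows A4-107 (`Weil.not_hasPureDim_one`) and A4-101/A4-98 (`Weil.not_hasPureDim_three`): no closed analytic
  subset of pure dimension `1`, `2` or `3` (`Weil.not_hasPureDim_of_pos_of_lt`);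
* `Weil.analyticSubsetsFinite : ComplexTorus.AnalyticSubsetsFinite Weil.periodEquiv` — **VOISIN'S ASSUMPTION (b):
  every closed analytic subset `Z ≠ X` of the explicit torus of Weil type is finite** (regular points of `Z` have
  codimension `4` by the three exclusions and the decomposition by dimension, Chirka §5.2 Thm. 1; `sng Z = ∅` by
  Cartan–Whitney and `dim sng Z < dim Z`, Chirka §5.2 Thm. 2; isolated points of a compact set are finitely many).
  This is the hypothesis `h₂` of the tree's assembly `Voisin2002_weilTorus_hodgeClassWithoutSubvarieties_of_leaves`
  (the barrier fact is discharged in `Literature/Barriers/HodgeConjecture/KaehlerCoherentSheavesWeilTorusHolds.lean`).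

This is Voisin's remark (IMRN 2002, §3, after Prop. 3): the Weil classes of a general torus of Weil type are not
classes of analytic cycles — here in the sharper form available for the explicit torus: the class of an analytic
surface would be a non-zero integral class in `span_ℂ(Ω, Ω̄)` pairing non-negatively with every complex `2`-plane
(Wirtinger / Lelong positivity, the tree's `analyticCycleClass_apply_complexFrame_nonneg_of_orientationSign_eq_one`),
and no such class exists because the hermitian form attached to the Weil structure is indefinite on this family
(signature `(2,2)`: `dz₀, dz₁` versus `dz₂, dz₃`).

No named fact, no instance, no notation; no new definition.

## References

* [Voisin2002KaehlerCounterexample] C. Voisin, IMRN 2002 no. 20, 1057–1075, §2 (a)–(b), §3 pp. 5–6 and Prop. 3.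
* [VoisinHodgeI2002] C. Voisin, *Hodge Theory and Complex Algebraic Geometry I* (2002), §11.1.2–§11.1.3, Prop. 11.20.
* [Zucker1977] S. Zucker, *The Hodge conjecture for cubic fourfolds*, Compositio Math. 34 (1977), Appendix B p. 208.
* [GriffithsHarrisPrinciples1978] P. Griffiths, J. Harris, *Principles of Algebraic Geometry*, Ch. 0 §2 (Wirtinger).
* [Chirka1989] E. M. Chirka, *Complex Analytic Sets* (1989), §2.3, §3.3 Prop. 1, §5.2 Thms. 1–2, §14.2 Prop. 2.
-/

noncomputable section

open scoped Manifold ComplexConjugate ComplexOrder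
open Complex Module Set Function

namespace Literature.Geometry.Kaehler

namespace ComplexTorus

section Model

variable {ι : Type*} [Fintype ι] [DecidableEq ι] {E : Type*} [NormedAddCommGroup E] [NormedSpace ℂ E]
  [FiniteDimensional ℂ E] (Φ : (ι → ℝ) ≃L[ℝ] E)

/-! ### §1 The positivity form of the cycle-class obstruction in an arbitrary model -/

/-- Pull-back along the (surjective) change of presentation is injective: `γ' ∘ toEuclideanModel = 0 ⇒ γ' = 0`.
[folklore] -/
private theorem eq_zero_of_comp_toEuclideanModel_eq_zero' {k : ℕ}
    {γ' : EuclideanSpace ℂ (Fin (finrank ℂ E)) [⋀^Fin k]→L[ℝ] ℂ}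
    (h : γ'.compContinuousLinearMap (realRep Φ (euclideanPresentation Φ) (1 : Matrix ι ι ℤ)) = 0) : γ' = 0 := by
  ext v
  have hv : (fun i ↦ realRep Φ (euclideanPresentation Φ) (1 : Matrix ι ι ℤ) ((toEuclideanModel E).symm (v i))) = v := by
    funext i
    rw [realRep_one_euclideanPresentation, ContinuousLinearMap.coe_restrictScalars', ContinuousLinearEquiv.coe_coe,
      ContinuousLinearEquiv.apply_symm_apply]
  have h' := congrArg (fun δ : E [⋀^Fin k]→L[ℝ] ℂ ↦ δ (fun i ↦ (toEuclideanModel E).symm (v i))) h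
  simp only [ContinuousAlternatingMap.compContinuousLinearMap_apply, Function.comp_def, hv,
    ContinuousAlternatingMap.coe_zero, Pi.zero_apply] at h'
  rw [h', ContinuousAlternatingMap.coe_zero, Pi.zero_apply]

/-- **No non-zero integral `(p,p)`-class non-negative on the complex `p`-frames ⇒ no closed analytic subset of
codimension `p` — in ANY model.** For the torus `X = E/Φ(ℤ^ι)` on a finite-dimensional complex normed space `E`
(`rk Λ = 2d + 2p`): if every integral class `γ` of type `(p,p)` with `γ(v₀, i v₀, …, v_{p−1}, i v_{p−1}) ≥ 0` for all
`v : Fin p → E` vanishes, then `X` has no closed analytic subset of pure dimension `d` (the class of such a subset is a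
non-zero integral `(p,p)`-class, non-negative on complex frames by Wirtinger–Lelong; tree
`not_hasPureDim_of_forall_nonneg_integralHodgeClass_eq_zero` in the Euclidean presentation, transported along the
`ℂ`-linear change of model, which maps complex frames to complex frames).
[cite: VoisinHodgeI2002, §11.1.3 Prop. 11.20] [cite: Chirka1989, §14.2 Prop. 2 and §2.3] -/
theorem not_hasPureDim_of_forall_nonneg_integralHodgeClass_eq_zero_model {n d p : ℕ} (e : Fin n ≃ ι)
    (h : 2 * d + 2 * p = n)
    (hX : ∀ γ ∈ integralHodgeClasses Φ p,
      (∀ v : Fin p → E, 0 ≤ γ (fun k : Fin (2 * p) ↦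
        if Even (k : ℕ) then v ⟨(k : ℕ) / 2, by omega⟩ else Complex.I • v ⟨(k : ℕ) / 2, by omega⟩)) → γ = 0)
    (Z : Set (ComplexTorus Φ)) : ¬ HasPureDim 𝓘(ℂ, E) Z d := by
  intro hZ
  refine not_hasPureDim_of_forall_nonneg_integralHodgeClass_eq_zero (euclideanPresentation Φ) e h
    (fun γ' hγ' hpos ↦ ?_) _ hZ.euclideanPresentation
  refine eq_zero_of_comp_toEuclideanModel_eq_zero' Φ
    (hX _ (comp_toEuclideanModel_mem_integralHodgeClasses Φ hγ') fun v ↦ ?_)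
  have hf : (⇑(realRep Φ (euclideanPresentation Φ) (1 : Matrix ι ι ℤ)) ∘ fun k : Fin (2 * p) ↦
      if Even (k : ℕ) then v ⟨(k : ℕ) / 2, by omega⟩ else Complex.I • v ⟨(k : ℕ) / 2, by omega⟩) =
      complexFrame fun j ↦ realRep Φ (euclideanPresentation Φ) (1 : Matrix ι ι ℤ) (v j) := by
    funext k
    by_cases hk : Even (k : ℕ)
    · simp only [Function.comp_apply, complexFrame, if_pos hk]
    · simp only [Function.comp_apply, complexFrame, if_neg hk, realRep_one_euclideanPresentation_smul]
  rw [ContinuousAlternatingMap.compContinuousLinearMap_apply, hf]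
  exact hpos _

end Model

end ComplexTorus

/-! ### §2 The Weil form on complex `2`-frames -/

namespace Weil

open ComplexTorus

/-- **The Weil form as a determinant**: `Ω(v₀, v₁, v₂, v₃) = det (M)`, `M_{r c} = (z₀(v_r), z₁(v_r), z̄₂(v_r),
z̄₃(v_r))_c` (`Ω = dz₀ ∧ dz₁ ∧ dz̄₂ ∧ dz̄₃` is the alternation of `dz₀ ⊗ dz₁ ⊗ dz̄₂ ⊗ dz̄₃`; Leibniz formula).
[cite: Zucker1977, Appendix B p. 208] [cite: Voisin2002KaehlerCounterexample, §3 pp. 5–6] -/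
theorem Omega_eq_det (v : Fin 4 → (Fin 4 → ℂ)) :
    Omega v = (Matrix.of fun r c : Fin 4 ↦ (![v r 0, v r 1, conj (v r 2), conj (v r 3)] : Fin 4 → ℂ) c).det := by
  rw [Matrix.det_apply, Omega, ContinuousMultilinearMap.alternatization_apply_apply]
  refine Finset.sum_congr rfl fun σ _ ↦ ?_
  rw [OmegaAux_apply, Fin.prod_univ_four]
  simp only [Function.comp_apply, Matrix.of_apply, Matrix.cons_val_zero, Matrix.cons_val_one, Matrix.cons_val]

/-- Leibniz expansion of a `4 × 4` determinant (the `24` signed products). [folklore] -/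
private theorem det_fin_four' {R : Type*} [CommRing R] (M : Matrix (Fin 4) (Fin 4) R) : M.det =
      M 0 0 * M 1 1 * M 2 2 * M 3 3 - M 0 0 * M 1 1 * M 2 3 * M 3 2 - M 0 0 * M 1 2 * M 2 1 * M 3 3 +
      M 0 0 * M 1 2 * M 2 3 * M 3 1 + M 0 0 * M 1 3 * M 2 1 * M 3 2 - M 0 0 * M 1 3 * M 2 2 * M 3 1 -
      M 0 1 * M 1 0 * M 2 2 * M 3 3 + M 0 1 * M 1 0 * M 2 3 * M 3 2 + M 0 1 * M 1 2 * M 2 0 * M 3 3 -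
      M 0 1 * M 1 2 * M 2 3 * M 3 0 - M 0 1 * M 1 3 * M 2 0 * M 3 2 + M 0 1 * M 1 3 * M 2 2 * M 3 0 +
      M 0 2 * M 1 0 * M 2 1 * M 3 3 - M 0 2 * M 1 0 * M 2 3 * M 3 1 - M 0 2 * M 1 1 * M 2 0 * M 3 3 +
      M 0 2 * M 1 1 * M 2 3 * M 3 0 + M 0 2 * M 1 3 * M 2 0 * M 3 1 - M 0 2 * M 1 3 * M 2 1 * M 3 0 -
      M 0 3 * M 1 0 * M 2 1 * M 3 2 + M 0 3 * M 1 0 * M 2 2 * M 3 1 + M 0 3 * M 1 1 * M 2 0 * M 3 2 -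
      M 0 3 * M 1 1 * M 2 2 * M 3 0 - M 0 3 * M 1 2 * M 2 0 * M 3 1 + M 0 3 * M 1 2 * M 2 1 * M 3 0 := by
  rw [Matrix.det_succ_row_zero, Fin.sum_univ_four]
  simp [Matrix.det_fin_three, Matrix.submatrix_apply, Fin.succAbove, Fin.succ]
  ring

/-- **Values of `Ω` on the complex `2`-frames `(u, iu, w, iw)`, `u = e₀ + c e₂`, `w = e₁ + e₃`: `Ω = 4 c̄`.**
[cite: Voisin2002KaehlerCounterexample, §3 pp. 5–6] -/
theorem Omega_twoFrame (c : ℂ) :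
    Omega ![![1, 0, c, 0], Complex.I • ![1, 0, c, 0], ![0, 1, 0, 1], Complex.I • ![0, 1, 0, 1]] = 4 * conj c := by
  rw [Omega_eq_det, det_fin_four']
  simp only [Matrix.of_apply, Matrix.cons_val_zero, Matrix.cons_val_one, Matrix.cons_val, Pi.smul_apply,
    smul_eq_mul, mul_one, mul_zero, map_zero, map_one, map_mul, Complex.conj_I]
  ring_nf
  rw [Complex.I_sq]
  ring

/-- **Sign change of the Weil classes on complex `2`-planes**: a form `γ = a Ω + b Ω̄` in the complexified Weil plane
which is non-negative on every complex `2`-frame `(u, iu, w, iw)` is zero (the frames `u = e₀ ± e₂, e₀ ± i e₂`,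
`w = e₁ + e₃` give `±4(a + b) ≥ 0` and `±4i(b − a) ≥ 0`). Voisin 2002 §3: the Weil classes are not classes of
effective analytic cycles. [cite: Voisin2002KaehlerCounterexample, §3 pp. 5–6 and Prop. 3] [cite: VoisinHodgeI2002, §11.1.2] -/
theorem eq_zero_of_mem_span_Omega_of_forall_nonneg {γ : (Fin 4 → ℂ) [⋀^Fin 4]→L[ℝ] ℂ}
    (hγ : γ ∈ Submodule.span ℂ (Set.range ![Omega, OmegaBar]))
    (hpos : ∀ u w : Fin 4 → ℂ, 0 ≤ γ ![u, Complex.I • u, w, Complex.I • w]) : γ = 0 := by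
  obtain ⟨cf, rfl⟩ := (Submodule.mem_span_range_iff_exists_fun ℂ).1 hγ
  have hval : ∀ c : ℂ, (∑ i, cf i • (![Omega, OmegaBar] : Fin 2 → (Fin 4 → ℂ) [⋀^Fin 4]→L[ℝ] ℂ) i)
      ![![1, 0, c, 0], Complex.I • ![1, 0, c, 0], ![0, 1, 0, 1], Complex.I • ![0, 1, 0, 1]] =
      4 * (cf 0 * conj c + cf 1 * c) := by
    intro c
    simp only [Fin.sum_univ_two, ContinuousAlternatingMap.add_apply, ContinuousAlternatingMap.smul_apply,
      Matrix.cons_val_zero, Matrix.cons_val_one, OmegaBar_apply, Omega_twoFrame, map_mul, map_ofNat,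
      Complex.conj_conj, smul_eq_mul]
    ring
  have h1 := hpos ![1, 0, 1, 0] ![0, 1, 0, 1]
  have h2 := hpos ![1, 0, -1, 0] ![0, 1, 0, 1]
  have h3 := hpos ![1, 0, Complex.I, 0] ![0, 1, 0, 1]
  have h4 := hpos ![1, 0, -Complex.I, 0] ![0, 1, 0, 1]
  rw [hval 1] at h1
  rw [hval (-1)] at h2
  rw [hval Complex.I] at h3
  rw [hval (-Complex.I)] at h4
  simp only [map_one, mul_one] at h1
  simp only [map_neg, map_one, mul_neg, mul_one, ← neg_add, mul_neg] at h2
  simp only [Complex.conj_I, mul_neg] at h3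
  simp only [map_neg, Complex.conj_I, neg_neg, mul_neg] at h4
  -- `4(a+b) ≥ 0`, `-4(a+b) ≥ 0` ⇒ `a + b = 0`; `4(-ia + ib) ≥ 0`, `-4(-ia + ib) ≥ 0` ⇒ `a = b`
  have hab : cf 0 + cf 1 = 0 := by
    have h0 : (4 : ℂ) * (cf 0 + cf 1) = 0 := le_antisymm (neg_nonneg.1 h2) h1
    simpa using h0
  have hab' : -(cf 0 * Complex.I) + cf 1 * Complex.I = 0 := by
    have h0 : (4 : ℂ) * (-(cf 0 * Complex.I) + cf 1 * Complex.I) = 0 := by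
      refine le_antisymm (neg_nonneg.1 ?_) h3
      have e : -((4 : ℂ) * (-(cf 0 * Complex.I) + cf 1 * Complex.I)) = 4 * (cf 0 * Complex.I + -(cf 1 * Complex.I)) := by
        ring
      rw [e]
      exact h4
    simpa using h0
  have hb : cf 1 = cf 0 := by
    have h0 : (cf 1 - cf 0) * Complex.I = 0 := by linear_combination hab'
    simpa [sub_eq_zero, Complex.I_ne_zero] using h0
  have ha : cf 0 = 0 := by linear_combination (hab - hb) / 2
  have hb0 : cf 1 = 0 := by rw [hb, ha]
  simp [Fin.sum_univ_two, ha, hb0]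

/-- **Every integral `(2,2)`-class of the explicit torus of Weil type which is non-negative on all complex `2`-frames
vanishes** (`B²(X) ⊗ ℂ = span_ℂ(Ω, Ω̄)` by FILE A, and the sign change above).
[cite: Voisin2002KaehlerCounterexample, §3 pp. 5–6 and Prop. 3] -/
theorem eq_zero_of_mem_integralHodgeClasses_two_of_forall_nonneg {γ : (Fin 4 → ℂ) [⋀^Fin 4]→L[ℝ] ℂ}
    (hγ : γ ∈ integralHodgeClasses periodEquiv 2)
    (hpos : ∀ u w : Fin 4 → ℂ, 0 ≤ γ ![u, Complex.I • u, w, Complex.I • w]) : γ = 0 :=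
  eq_zero_of_mem_span_Omega_of_forall_nonneg (mem_span_Omega_of_mem_integralHodgeClasses_two hγ) hpos

/-- The complex `2`-frame of `v = (v₀, v₁)` in the slot convention of `complexFrame` is `(v₀, i v₀, v₁, i v₁)`.
[folklore] -/
private theorem twoFrame_eq (v : Fin 2 → (Fin 4 → ℂ)) :
    (fun k : Fin (2 * 2) ↦ if Even (k : ℕ) then v ⟨(k : ℕ) / 2, by omega⟩ else Complex.I • v ⟨(k : ℕ) / 2, by omega⟩) =
      ![v 0, Complex.I • v 0, v 1, Complex.I • v 1] := by
  funext k
  fin_cases k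
  · simp
  · simp
  · simp [show Even 2 from ⟨1, rfl⟩]
  · simp [show ¬ Even 3 by decide]

/-! ### §3 No analytic surface on the explicit torus of Weil type -/

/-- **THE EXPLICIT COMPLEX TORUS OF WEIL TYPE `X = ℂ⁴/Φ(ℤ⁸)` HAS NO CLOSED ANALYTIC SUBSET OF PURE DIMENSION TWO**
(no analytic surface): its integral Hodge classes of degree `4` lie in `span_ℂ(Ω, Ω̄)` (FILE A), none of whose
non-zero members is non-negative on all complex `2`-planes, whereas the class of an analytic surface would be
(Wirtinger–Lelong). Voisin's assumption (b) for this torus in dimension two; with `Weil.not_hasPureDim_one` (A4-107) and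
`Weil.not_hasPureDim_three` (A4-101) all positive dimensions `< 4` are excluded.
[cite: Voisin2002KaehlerCounterexample, §2 (a)–(b), §3 pp. 5–6 and Prop. 3] [cite: VoisinHodgeI2002, §11.1.3 Prop. 11.20] -/
theorem not_hasPureDim_two (Z : Set (ComplexTorus periodEquiv)) : ¬ HasPureDim 𝓘(ℂ, Fin 4 → ℂ) Z 2 := by
  refine not_hasPureDim_of_forall_nonneg_integralHodgeClass_eq_zero_model periodEquiv (n := 8) (d := 2) (p := 2)
    (Equiv.refl (Fin 8)) (by norm_num) (fun γ hγ hpos ↦ ?_) Z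
  refine eq_zero_of_mem_integralHodgeClasses_two_of_forall_nonneg hγ fun u w ↦ ?_
  have h := hpos ![u, w]
  rw [twoFrame_eq] at h
  simpa using h

/-- **No closed analytic subset of pure dimension `d`, `0 < d < 4`, on the explicit torus of Weil type** (rows A4-101,
A4-107, A4-108: no hypersurface, no curve, no surface). [cite: Voisin2002KaehlerCounterexample, §2 (a)–(b) and §3 Prop. 3] -/
theorem not_hasPureDim_of_pos_of_lt {d : ℕ} (h0 : 0 < d) (h4 : d < 4) (Z : Set (ComplexTorus periodEquiv)) :
    ¬ HasPureDim 𝓘(ℂ, Fin 4 → ℂ) Z d := by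
  interval_cases d
  · exact not_hasPureDim_one Z
  · exact not_hasPureDim_two Z
  · exact not_hasPureDim_three Z

/-- Codimension form: no closed analytic subset of pure codimension two. [cite: Voisin2002KaehlerCounterexample, §2 (a)–(b) and §3 Prop. 3] -/
theorem not_hasPureCodim_two (Z : Set (ComplexTorus periodEquiv)) : ¬ HasPureCodim 𝓘(ℂ, Fin 4 → ℂ) Z 2 :=
  fun hZ ↦ not_hasPureDim_two Z ⟨2, by simp, hZ⟩

/-! ### §4 Every proper closed analytic subset of the explicit torus of Weil type is finite -/

/-- **Every regular point of a proper closed analytic subset `Z ⊊ X` of the explicit torus of Weil type has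
codimension `4`**: codimension `0` is excluded by the identity theorem (`Z ≠ X`, `X` connected;
`IsAnalyticSet.one_le_of_ne_univ`), and a regular point of codimension `c ∈ {1, 2, 3}` would make the closure of the
stratum `regularLocusOfCodim Z c` a closed analytic subset of pure codimension `c` (Chirka §5.2 Thm. 1,
`IsAnalyticSet.hasPureCodim_closure_regularLocusOfCodim_holds`), excluded by rows A4-101, A4-108, A4-107.
[cite: Chirka1989, §5.2 Thm. 1, p. 53] [cite: Voisin2002KaehlerCounterexample, §2 (b) and §3 Prop. 3] -/
theorem four_le_codim_of_isAnalyticSet {Z : Set (ComplexTorus periodEquiv)} (hZ : IsAnalyticSet 𝓘(ℂ, Fin 4 → ℂ) Z)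
    (hZu : Z ≠ univ) (z : ComplexTorus periodEquiv) (c : ℕ) (hz : z ∈ Z)
    (hreg : IsRegularPointOfCodim 𝓘(ℂ, Fin 4 → ℂ) Z c z) : 4 ≤ c := by
  have hc4 : c ≤ 4 := by simpa using hreg.le_finrank
  have hc1 : 1 ≤ c := hZ.one_le_of_ne_univ hZu z ⟨hz, c, hreg⟩ c hreg
  have hne : (regularLocusOfCodim 𝓘(ℂ, Fin 4 → ℂ) Z c).Nonempty := ⟨z, hz, hreg⟩
  have hpure : HasPureCodim 𝓘(ℂ, Fin 4 → ℂ) (closure (regularLocusOfCodim 𝓘(ℂ, Fin 4 → ℂ) Z c)) c :=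
    IsAnalyticSet.hasPureCodim_closure_regularLocusOfCodim_holds 𝓘(ℂ, Fin 4 → ℂ) (ComplexTorus periodEquiv) hZ hne
  interval_cases c
  · exact absurd hpure (not_hasPureCodim_one _)
  · exact absurd hpure (not_hasPureCodim_two _)
  · exact absurd hpure (not_hasPureCodim_three _)
  · exact le_rfl

/-- **A proper closed analytic subset of the explicit torus of Weil type has no singular points**: its regular points
have codimension `4 = dim X`, so the regular points of the analytic set `sng Z` (Cartan–Whitney,
`isAnalyticSet_singularLocus_holds`) would have codimension `≥ 5` (Chirka §5.2 Thm. 2,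
`IsAnalyticSet.succ_le_codim_singularLocus`) — there are none, and an analytic set without regular points is empty
(density of regular points, Chirka §2.3). [cite: Chirka1989, §5.2 Thm. 2, p. 53 and §2.3] -/
theorem singularLocus_eq_empty_of_isAnalyticSet {Z : Set (ComplexTorus periodEquiv)}
    (hZ : IsAnalyticSet 𝓘(ℂ, Fin 4 → ℂ) Z) (hZu : Z ≠ univ) : singularLocus 𝓘(ℂ, Fin 4 → ℂ) Z = ∅ := by
  have hS : IsAnalyticSet 𝓘(ℂ, Fin 4 → ℂ) (singularLocus 𝓘(ℂ, Fin 4 → ℂ) Z) :=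
    isAnalyticSet_singularLocus_holds 𝓘(ℂ, Fin 4 → ℂ) (ComplexTorus periodEquiv) hZ
  have hregS : regularLocus 𝓘(ℂ, Fin 4 → ℂ) (singularLocus 𝓘(ℂ, Fin 4 → ℂ) Z) = ∅ := by
    refine Set.eq_empty_iff_forall_notMem.2 fun w hw ↦ ?_
    obtain ⟨hwS, c, hreg⟩ := hw
    have h5 : 4 + 1 ≤ c := hZ.succ_le_codim_singularLocus (four_le_codim_of_isAnalyticSet hZ hZu) hwS hreg
    have hc4 : c ≤ 4 := by simpa using hreg.le_finrank
    omega
  refine Set.eq_empty_iff_forall_notMem.2 fun y hy ↦ ?_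
  have h := IsAnalyticSet.subset_closure_regularLocus_holds 𝓘(ℂ, Fin 4 → ℂ) (ComplexTorus periodEquiv) hS hy
  rw [hregS, closure_empty] at h
  exact h

/-- **Every point of a proper closed analytic subset of the explicit torus of Weil type is isolated in it** (a regular
point of codimension `dim X`; inverse function theorem). [cite: Chirka1989, §2.3] -/
theorem exists_nhds_inter_subset_singleton_of_isAnalyticSet {Z : Set (ComplexTorus periodEquiv)}
    (hZ : IsAnalyticSet 𝓘(ℂ, Fin 4 → ℂ) Z) (hZu : Z ≠ univ) {x : ComplexTorus periodEquiv} (hx : x ∈ Z) :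
    ∃ U ∈ nhds x, U ∩ Z ⊆ {x} := by
  have hxreg : x ∈ regularLocus 𝓘(ℂ, Fin 4 → ℂ) Z := by
    have h := regularLocus_union_singularLocus (I := 𝓘(ℂ, Fin 4 → ℂ)) Z
    rw [singularLocus_eq_empty_of_isAnalyticSet hZ hZu, union_empty] at h
    rw [h]
    exact hx
  obtain ⟨-, c, hreg⟩ := hxreg
  have hc : c = 4 := le_antisymm (by simpa using hreg.le_finrank) (four_le_codim_of_isAnalyticSet hZ hZu x c hx hreg)
  subst hc
  have hreg' : IsRegularPointOfCodim 𝓘(ℂ, Fin 4 → ℂ) Z (finrank ℂ (Fin 4 → ℂ)) x := by simpa using hreg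
  exact hreg'.exists_nhds_inter_subset_singleton hx

/-- **VOISIN'S ASSUMPTION (b) FOR THE EXPLICIT TORUS OF WEIL TYPE: every closed analytic subset `Z ≠ X` of
`X = ℂ⁴/Φ(ℤ⁸)` is finite** ("`X` contains no proper closed analytic subset of positive dimension"). The tree's
`ComplexTorus.AnalyticSubsetsFinite Weil.periodEquiv`, obtained NOT from Ueno's structure theory of subvarieties of
tori (the route of `KaehlerCoherentSheavesSplit.lean`) but from the cycle classes: `B¹(X) = B³(X) = 0` and `B²(X) =`
the Weil plane, whose non-zero members change sign on complex `2`-planes, exclude analytic subsets of dimension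
`3, 1, 2`; dimension theory (Chirka §5.2) and compactness then leave finitely many points.
[cite: Voisin2002KaehlerCounterexample, §2 (b) and §3 Prop. 3, p. 1063] [cite: Chirka1989, §3.3 Prop. 1 and §5.2] -/
theorem analyticSubsetsFinite : ComplexTorus.AnalyticSubsetsFinite periodEquiv := by
  intro Z hZ hZu
  choose! U hU hUZ using fun x (hx : x ∈ Z) ↦ exists_nhds_inter_subset_singleton_of_isAnalyticSet hZ hZu hx
  obtain ⟨t, htZ, hcover⟩ := hZ.isClosed.isCompact.elim_nhds_subcover U fun x hx ↦ hU x hx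
  refine t.finite_toSet.subset fun y hy ↦ ?_
  obtain ⟨x, hxt, hyU⟩ := mem_iUnion₂.1 (hcover hy)
  have hyx : y ∈ ({x} : Set (ComplexTorus periodEquiv)) := hUZ x (htZ x hxt) ⟨hyU, hy⟩
  rw [mem_singleton_iff.1 hyx]
  exact hxt

end Weil

end Literature.Geometry.Kaehler

end
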